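import Literature.Topology.FourManifolds.FramedSphereThomReading
import Literature.Topology.FourManifolds.HomotopySpheresSignatureLemma71Surgery
import HarnessLib

/-!
# Kervaire–Milnor's Lemma 7.1: the homological hypotheses of the surgery from the printed data,
# and Thm. 7.5 / Cor. 7.6 / `Θ₇` over the geometric residual

Topic `Literature/Topology/FourManifolds` (fact seat of
`Literature.Topology.FourManifolds.HomotopySphere.mk_eq_mk_iff_sigmaGen_dvd_sub`, Kervaire–Milnor's
Thm. 7.5). Sequel of `HomotopySpheresSignatureLemma71Surgery.lean`, whose hypothesis `hrep` —
*a framed family of disjoint embedded `2m`-spheres in `M` with `ρ : H₂ₘ(M) → H₂ₘ(M | ⋃ Sᵢ)` onto and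
`ker ρ` spanned by the sphere classes* — mixed the differential topology of Kervaire–Milnor's proof
of Lemma 7.1 (M. Kervaire, J. Milnor, *Groups of homotopy spheres I*, Ann. of Math. 77 (1963),
p. 527 l. 1–6: "According to [17, Lemma 6] or Haefliger [6] any homology class in `HₖM` can be
represented by a differentiably imbedded sphere … Since the normal bundle is trivial, `φ₀` can be
extended to an imbedding `φ : Sᵏ × Dᵏ → M`") with its homological reading (p. 527 l. 7–9: "Since
`μᵣ·λᵣ = 1` it follows that `Hₖ₋₁M₀ = 0` … The group `HₖM₀` is isomorphic to the subgroup of `HₖM`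
generated by `{λ₁, …, λᵣ, μ₁, …, μᵣ₋₁}`", the pairing `λ·μ` being Poincaré duality and cup product
on the closed model, footnote pp. 528–529). Here the homological reading is PROVED, so that the
residual hypothesis is purely geometric:

* `localHomologyOfSet.eq_zero_of_restrictLocal_union`, `…_biUnion` — a class of
  `H_q(X | ⋃ Kᵢ)` (finite disjoint closed union) vanishing on every `Kᵢ` is zero (relative
  Mayer–Vietoris, Hatcher §2.2 p. 152).
* `NullCobordism.isOpenEmbedding_boundaryCollapse_comp_tube` — the tubes of a framed family pushed
  to the closed model `M̂ = M ∪ cone(bM)` are open embeddings.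
* `HomotopySphere.eq_zero_of_mem_torsion_singularHomology_closedModel` — **`HₖM` (hence `HₖM̂`) is
  torsion-free** for a simply connected null-cobordism `M` of a homotopy sphere with `Hₖ₋₁M = 0`,
  `k + k = dim M`, `k ≥ 3` (p. 528: "Using the Poincaré duality theorem it follows that `HₖM` is free
  abelian": Lefschetz duality `Hᵏ(M) ≅ Hₖ(M, bM) ≅ Hₖ(M)` and universal coefficients).
* `HomotopySphere.surjective_toLocalOfSet_cores_and_ker_le_span` — **the homological hypotheses of
  the surgical engine from the printed data**: for a Kervaire–Milnor basis `{λᵢ, μⱼ}` of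
  `Hᵏ(M̂; ℤ)/T` (`λᵢ·λⱼ = 0`, `λᵢ·μⱼ = δᵢⱼ`) and a framed family `ν` of `r` disjoint embedded
  `k`-spheres in `M` whose classes in `Hₖ(M̂)` are Poincaré dual to lifts of the `λᵢ`,
  `ρ : Hₖ(M) → Hₖ(M | ⋃ Sᵢ)` is onto (the classes `q_*⁻¹(μⱼ ⌢ [M̂])` are dual to the spheres) and
  `ker ρ` is spanned by the sphere classes. Ingredients: the reading of `Hₖ(M̂ | q Sᵢ)` by the
  Poincaré dual of the sphere (`SphereProd.SphereTube.exists_reading`, `FramedSphereThomReading.lean`),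
  `q_* : Hₖ(M) ≅ Hₖ(M̂)` (`isIso_singularHomologyMap_boundaryCollapse`), duality modulo torsion on
  `M̂` (`closedModel_dualityModTorsion_of_isOrientedBy`), torsion-freeness, and the excision
  `Hₖ(M | Sᵢ) ≅ Hₖ(M̂ | q Sᵢ)`.
* `HomotopySphere.sphereFamily_of_representation` — `hrep` of `lemma71_of_sphereFamily` from the
  geometric hypothesis (`hgeo`) below; `HomotopySphere.mk_eq_mk_iff_sigmaGen_dvd_sub_of_representation`
  (Thm. 7.5), `HomotopySphereClass.isCyclic_bP_four_mul_of_representation` (Cor. 7.6) and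
  `exists_commGroup_homotopySphereClass_isCyclic_seven_of_representation` (`Θ₇` cyclic) over it.

So the printed results separating the tree from `mk_eq_mk_iff_sigmaGen_dvd_sub_holds` are now
exactly three statements of differential topology, all taken as plain hypotheses (nothing is
asserted, no named fact is introduced): (`hgeo`) **the geometric half of Lemma 7.1** — in a simply
connected, `(2m-1)`-connected, s-parallelizable null-cobordism of a homotopy sphere (`4m ≥ 8`),
classes `λ₁, …, λᵣ ∈ H²ᵐ(M̂; ℤ)` with all `λᵢ·λⱼ = 0` are Poincaré dual to the classes of `r`
disjoint framed embedded `2m`-spheres ([17, Lemma 6] / Haefliger: embedding, `k ≥ 3`; Whitney's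
procedure, Milnor 1965 Thm. 6.6, for disjointness — compare Wall, *Surgery on compact manifolds*
(1970), Thm. 5.2 (ii); [17, Lemma 7] / Kosinski X.3.1: an embedded `2m`-sphere with
self-intersection `0` in a π-manifold has trivial normal bundle); (`hconn`) the named fact
`HomotopySphere.exists_highlyConnected_of_mem_signatureSet` (Kosinski X.2.2, Kervaire–Milnor
Thm. 5.5: framed surgery below the middle dimension); (`hcob`) the named fact
`nonempty_diffeomorph_of_isHCobordant_of_five_le` (Smale's h-cobordism theorem). Everything else
along the printed proof of Thm. 7.5 is a theorem of the tree.

## References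

* M. Kervaire, J. Milnor, *Groups of homotopy spheres I*, Ann. of Math. 77 (1963), 504–537:
  Lemma 7.1 and its proof (pp. 526–528), §7 p. 528 with footnote pp. 528–529, Lemma 7.3 (proof
  p. 529), Thm. 7.5 (pp. 529–530), Cor. 7.6 (p. 530). doi:10.2307/1970128 [KervaireMilnorAnnals1963]
* J. Milnor, *A procedure for killing the homotopy groups of differentiable manifolds*, Proc.
  Sympos. Pure Math. III (1961), Lemmas 6, 7. [MilnorKilling1961]
* J. Milnor, *Lectures on the h-cobordism theorem* (1965), Thm. 6.6 (Whitney's procedure), Thm. 9.1.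
  [MilnorHCobordism1965]
* A. Kosinski, *Differential Manifolds* (1993), Ch. X: Prop. (3.1), Thm. (2.2), Thm. (3.4) and its
  proof (p. 205), §3 p. 204. [Kosinski1993]
* A. Hatcher, *Algebraic Topology* (2002), §2.2 p. 152, Lemma 3.27, Thm. 3.43, Thm. 2.16, Thm. 3.2,
  Cor. 3.3. [HatcherAT2002]
-/

noncomputable section

open scoped Manifold Topology ContDiff
open Set Function CategoryTheory CategoryTheory.Limits Topology
open Literature.AlgebraicTopology.SingularHomology

namespace Literature.Topology.FourManifolds

/-! ### Local homology along a finite disjoint union of closed sets is detected on the pieces -/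

section LocalUnion

variable {X : Type} [TopologicalSpace X]

/-- **Relative Mayer–Vietoris, injectivity for disjoint closed sets**: a class of
`H_q(X | A ∪ B)` with `A ∩ B = ∅` vanishing on `A` and on `B` is zero (exactness at
`H_q(X | A ∪ B)`, the previous term `H_{q+1}(X | A ∩ B) = H_{q+1}(X | ∅)` being zero).
[cite: HatcherAT2002, §2.2 p. 152 and Lemma 3.27] -/
theorem localHomologyOfSet.eq_zero_of_restrictLocal_union {A B : Set X} (hA : IsClosed A)
    (hB : IsClosed B) (hAB : A ∩ B = ∅) (q : ℕ) (z : localHomologyOfSet ℤ ℤ X (A ∪ B) q)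
    (hzA : restrictLocal ℤ ℤ (subset_union_left : A ⊆ A ∪ B) q z = 0)
    (hzB : restrictLocal ℤ ℤ (subset_union_right : B ⊆ A ∪ B) q z = 0) : z = 0 := by
  have h0 : IsZero (clocalHomology ℤ ℤ X (A ∩ B) (q + 1)) := by
    rw [hAB]; exact clocalHomology.isZero_empty ℤ ℤ (q + 1)
  haveI := ModuleCat.subsingleton_of_isZero h0
  have h₁ := clocalHomology.mv_exact₁ ℤ ℤ hA hB q
  set z' := (localHomologyOfSet.cmpIso ℤ ℤ X (A ∪ B) q).hom z with hz'
  have hres : clocalHomology.mvRes ℤ ℤ A B q z' = 0 := by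
    rw [clocalHomology.mvRes, LinearMap.prod_apply, Prod.mk_eq_zero]
    constructor
    · change clocalHomology.res ℤ ℤ X subset_union_left q z' = 0
      rw [hz', localHomologyOfSet.res_cmpIso_hom_apply, hzA, map_zero]
    · change clocalHomology.res ℤ ℤ X subset_union_right q z' = 0
      rw [hz', localHomologyOfSet.res_cmpIso_hom_apply, hzB, map_zero]
  obtain ⟨β, hβ⟩ := (h₁ z').1 hres
  have hz'0 : z' = 0 := by rw [← hβ, Subsingleton.elim β 0, map_zero]
  apply (localHomologyOfSet.cmpIso ℤ ℤ X (A ∪ B) q).toLinearEquiv.injective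
  rw [map_zero]
  exact hz'0

/-- **A class of `H_q(X | ⋃ᵢ Kᵢ)` (finite disjoint union of closed sets) vanishing on every `Kᵢ`
is zero** (induction on the number of pieces). [cite: HatcherAT2002, §2.2 p. 152 and Lemma 3.27] -/
theorem localHomologyOfSet.eq_zero_of_forall_restrictLocal_biUnion {ι : Type*} (K : ι → Set X)
    (hK : ∀ i, IsClosed (K i)) (hdisj : Pairwise (Disjoint on K)) (q : ℕ) (s : Finset ι) :
    ∀ (C : Set X) (hC : C = ⋃ i ∈ s, K i) (z : localHomologyOfSet ℤ ℤ X C q),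
      (∀ i (hi : i ∈ s), restrictLocal ℤ ℤ
        (show K i ⊆ C by rw [hC]; exact Finset.subset_set_biUnion_of_mem hi) q z = 0) → z = 0 := by
  classical
  induction s using Finset.induction_on with
  | empty =>
    intro C hC z _
    have he : C = ∅ := by simpa using hC
    subst he
    haveI := ModuleCat.subsingleton_of_isZero (isZero_localHomologyOfSet_empty ℤ ℤ (X := X) q)
    exact Subsingleton.elim _ _
  | insert j s hj ih =>
    intro C hC z hz
    have hC' : C = K j ∪ ⋃ i ∈ s, K i := by rw [hC, Finset.set_biUnion_insert]
    subst hC'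
    have hsc : IsClosed (⋃ i ∈ s, K i) := isClosed_biUnion_finset fun i _ ↦ hK i
    have hinter : K j ∩ (⋃ i ∈ s, K i) = ∅ := by
      refine Set.eq_empty_of_forall_notMem fun x ⟨hxj, hxs⟩ ↦ ?_
      obtain ⟨i, hi, hxi⟩ := Set.mem_iUnion₂.1 hxs
      have hij : j ≠ i := fun h ↦ hj (h ▸ hi)
      exact Set.disjoint_left.1 (hdisj hij) hxj hxi
    refine localHomologyOfSet.eq_zero_of_restrictLocal_union (hK j) hsc hinter q z
      (hz j (Finset.mem_insert_self j s)) ?_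
    refine ih _ rfl _ fun i hi => ?_
    rw [← ModuleCat.comp_apply, restrictLocal_comp]
    exact hz i (Finset.mem_insert_of_mem hi)

end LocalUnion

/-! ### The tubes of a framed family in a null-cobordism, pushed to the closed model -/

section Tubes

variable {n : ℕ} {M : Type} [TopologicalSpace M] [ChartedSpace (EuclideanSpace ℝ (Fin n)) M]

namespace NullCobordism

variable (c : NullCobordism n M) {ι : Type} {k l : ℕ}

/-- **The tube `φᵢ : Sᵏ × ℝˡ⁺¹ → M` of a framed family followed by the collapse
`q : M → M̂ = M ∪ cone(bM)` is an open embedding** (the tube lies in the interior, on which `q` is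
an open embedding). [cite: KervaireMilnorAnnals1963, §7, footnote pp. 528–529] [cite: Kosinski1993, Ch. X §2, p. 201] -/
theorem isOpenEmbedding_boundaryCollapse_comp_tube [T2Space M] [CompactSpace M] [IsManifold (𝓡 n) ∞ M]
    (ν : FramedSphereFamily (𝓡∂ (n + 1)) c.W ι k (l + 1)) (hkl : k + l = n) (i : ι) :
    IsOpenEmbedding (fun p => boundaryCollapse n c.W (ν.toFun i p)) := by
  -- corestrict the tube to the complement of the boundary
  have hmem : ∀ p, ν.toFun i p ∈ ((𝓡∂ (n + 1)).boundary c.W)ᶜ := fun p =>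
    ν.apply_not_mem_boundary hkl i p
  have h1 : IsOpenEmbedding (Set.codRestrict (ν.toFun i) (((𝓡∂ (n + 1)).boundary c.W)ᶜ) hmem) := by
    refine ⟨(ν.isOpenEmbedding_toFun i).isEmbedding.codRestrict _ hmem, ?_⟩
    have : range (Set.codRestrict (ν.toFun i) (((𝓡∂ (n + 1)).boundary c.W)ᶜ) hmem) =
        Subtype.val ⁻¹' range (ν.toFun i) := by
      ext x
      simp only [mem_range, mem_preimage]
      constructor
      · rintro ⟨p, rfl⟩; exact ⟨p, rfl⟩
      · rintro ⟨p, hp⟩; exact ⟨p, Subtype.ext hp⟩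
    rw [this]
    exact (ν.isOpen_range i).preimage continuous_subtype_val
  have h2 : IsOpenEmbedding (Subtype.val : ↥(({ClosedModel.infty}ᶜ : Set (ClosedModel n c.W))) → _) :=
    OnePoint.isClosed_infty.isOpen_compl.isOpenEmbedding_subtypeVal
  have h3 := (h2.comp c.interiorHomeo.isOpenEmbedding).comp h1
  convert h3 using 1
  funext p
  change boundaryCollapse n c.W (ν.toFun i p) = (c.interiorHomeo ⟨ν.toFun i p, hmem p⟩ : ClosedModel n c.W)
  rw [c.interiorHomeo_apply_coe']

end NullCobordism

end Tubes

/-! ### `Hₖ(M; ℤ)` and `Hₖ(M̂; ℤ)` are torsion-free for a highly connected null-cobordism -/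

section Torsion

variable {n : ℕ}

/-- **`Hₖ(M̂; ℤ)` is torsion-free** for `M̂ = M ∪ cone(bM)`, `M` a simply connected null-cobordism
of a homotopy `n`-sphere with `Hₖ₋₁(M; ℤ) = 0`, `k + k = n + 1`, `k ≥ 3` (Kervaire–Milnor p. 528:
"Using the Poincaré duality theorem it follows that `HₖM` is free abelian"): `q_* : Hₖ(M) ≅ Hₖ(M̂)`,
`j_* : Hₖ(M) ≅ Hₖ(M, bM)` (exact sequence of the pair), `Hᵏ(M) ≅ Hₖ(M, bM)` (Lefschetz duality,
`bijective_relCapProduct_of_isRelFundamentalClass_holds`) and `Hᵏ(M)` is torsion-free by universal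
coefficients (`torsion_singularCohomology_eq_bot_of_free`).
[cite: KervaireMilnorAnnals1963, §7 p. 528] [cite: HatcherAT2002, Thm. 3.43, Thm. 2.16, Cor. 3.3] -/
theorem HomotopySphere.eq_zero_of_mem_torsion_singularHomology_closedModel {k : ℕ} (hk : 3 ≤ k)
    (hkn : k + k = n + 1) (S : HomotopySphere n) (c : NullCobordism n S.carrier)
    [SimplyConnectedSpace c.W] (hH : IsZero (singularHomology ℤ ℤ c.W (k - 1)))
    (z : singularHomology ℤ ℤ (ClosedModel n c.W) k)
    (hz : z ∈ Submodule.torsion ℤ (singularHomology ℤ ℤ (ClosedModel n c.W) k)) : z = 0 := by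
  obtain ⟨k', rfl⟩ : ∃ k', k = k' + 1 := ⟨k - 1, by omega⟩
  obtain ⟨n', rfl⟩ : ∃ n', n = n' + 1 := ⟨n - 1, by omega⟩
  have hk' : k' + 1 - 1 = k' := by omega
  rw [hk'] at hH
  haveI : Nonempty S.carrier := S.nonempty
  -- `q_*` in degree `k` is an isomorphism
  have iq : IsIso (singularHomology.map ℤ ℤ (boundaryCollapse (n' + 1) c.W) (k' + 1)) :=
    S.isIso_singularHomologyMap_boundaryCollapse c k' (by omega) (by omega) (by omega)
  have hqb := (ConcreteCategory.isIso_iff_bijective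
    (singularHomology.map ℤ ℤ (boundaryCollapse (n' + 1) c.W) (k' + 1))).1 iq
  obtain ⟨x, rfl⟩ := hqb.2 z
  have hx : x ∈ Submodule.torsion ℤ (singularHomology ℤ ℤ c.W (k' + 1)) :=
    mem_torsion_of_injective_apply_mem_torsion
      (singularHomology.map ℤ ℤ (boundaryCollapse (n' + 1) c.W) (k' + 1)).hom hqb.1 hz
  suffices hx0 : x = 0 by rw [hx0, map_zero]
  -- `j_* : Hₖ(M) ≅ Hₖ(M, bM)`
  have hB : ∀ j, j ≠ 0 → j ≠ n' + 1 →
      IsZero (singularHomology ℤ ℤ ↥((𝓡∂ (n' + 1 + 1)).boundary c.W) j) :=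
    fun j hj hjn => S.isZero_singularHomology_boundary c hj hjn
  have ij : IsIso (relativeSingularHomology.ofAbsolute ℤ ℤ c.W ((𝓡∂ (n' + 1 + 1)).boundary c.W) (k' + 1)) :=
    isIso_ofAbsolute_of_isZero_of_isZero _ k' (hB _ (by omega) (by omega)) (hB _ (by omega) (by omega))
  have hjb := (ConcreteCategory.isIso_iff_bijective
    (relativeSingularHomology.ofAbsolute ℤ ℤ c.W ((𝓡∂ (n' + 1 + 1)).boundary c.W) (k' + 1))).1 ij
  have hjx : relativeSingularHomology.ofAbsolute ℤ ℤ c.W ((𝓡∂ (n' + 1 + 1)).boundary c.W) (k' + 1) x ∈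
      Submodule.torsion ℤ _ :=
    mem_torsion_map_of_mem_torsion
      (relativeSingularHomology.ofAbsolute ℤ ℤ c.W ((𝓡∂ (n' + 1 + 1)).boundary c.W) (k' + 1)).hom hx
  -- Lefschetz duality `Hᵏ(M) ≅ Hₖ(M, bM)`
  obtain ⟨zr, hzr⟩ := exists_isRelFundamentalClass_of_simplyConnectedSpace (n' + 1) c.W
  have hL : Bijective fun a : singularCohomology ℤ ℤ c.W (k' + 1) =>
      relCapProduct (M := ℤ) ((𝓡∂ (n' + 1 + 1)).boundary c.W)
        (show k' + 1 + (k' + 1) = n' + 1 + 1 by omega) a zr :=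
    bijective_relCapProduct_of_isRelFundamentalClass_holds (R := ℤ) (n' + 1) c.W zr hzr
      (p := k' + 1) (q := k' + 1) (by omega)
  -- the duality map as a linear map
  let L : singularCohomology ℤ ℤ c.W (k' + 1) →ₗ[ℤ]
      relativeSingularHomology ℤ ℤ c.W ((𝓡∂ (n' + 1 + 1)).boundary c.W) (k' + 1) :=
    { toFun := fun a => relCapProduct (M := ℤ) ((𝓡∂ (n' + 1 + 1)).boundary c.W)
        (show k' + 1 + (k' + 1) = n' + 1 + 1 by omega) a zr
      map_add' := fun a₁ a₂ => by simp only [map_add, LinearMap.add_apply]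
      map_smul' := fun t a => by
        simp only [LinearMap.map_smulₛₗ, LinearMap.smul_apply] }
  have hLf : ∀ a, L a = relCapProduct (M := ℤ) ((𝓡∂ (n' + 1 + 1)).boundary c.W)
      (show k' + 1 + (k' + 1) = n' + 1 + 1 by omega) a zr := fun a => rfl
  have hLb : Bijective L := hL
  obtain ⟨a', ha'⟩ := hLb.2
    (relativeSingularHomology.ofAbsolute ℤ ℤ c.W ((𝓡∂ (n' + 1 + 1)).boundary c.W) (k' + 1) x)
  have ha'T : a' ∈ Submodule.torsion ℤ (singularCohomology ℤ ℤ c.W (k' + 1)) :=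
    mem_torsion_of_injective_apply_mem_torsion L hLb.1 (by rw [ha']; exact hjx)
  -- universal coefficients: `Hᵏ(M)` is torsion-free since `Hₖ₋₁(M) = 0`
  haveI : Subsingleton (singularHomology ℤ ℤ c.W k') := ModuleCat.subsingleton_of_isZero hH
  haveI : Module.Free ℤ (singularHomology ℤ ℤ c.W k') := Module.Free.of_subsingleton ℤ _
  have hT := torsion_singularCohomology_eq_bot_of_free ℤ c.W k'
  rw [hT, Submodule.mem_bot] at ha'T
  subst ha'T
  have h0 : relativeSingularHomology.ofAbsolute ℤ ℤ c.W ((𝓡∂ (n' + 1 + 1)).boundary c.W) (k' + 1) x = 0 := by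
    rw [← ha', map_zero]
  apply hjb.1
  rw [h0, map_zero]

end Torsion

/-! ### Kervaire–Milnor p. 527: the homological hypotheses of Lemma 7.1 from the printed data -/

section Reading

variable {n : ℕ}

/-- **The two homological conditions of the surgical engine follow from the printed data**
(Kervaire–Milnor 1963, proof of Lemma 7.1, p. 527 l. 1–9 — "Choose an imbedding `φ₀ : Sᵏ → M`
so as to represent the homology class `λᵣ` … Since `μᵣ·λᵣ = 1` it follows that `Hₖ₋₁M₀ = 0`",
"The group `HₖM₀` is isomorphic to the subgroup of `HₖM` generated by `{λ₁, …, λᵣ, μ₁, …, μᵣ₋₁}`" —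
with the footnote pp. 528–529: the intersection pairing `λ·μ` is Poincaré duality followed by the
cup product on the closed homology manifold `M̂ = M ∪ cone(bM)`). Let `Σ` be a homotopy
`n`-sphere, `c` a simply connected null-cobordism (`M = c.W`) with `Hₖ₋₁(M; ℤ) = 0`, `k + k = n + 1`,
`k ≥ 3`, `μ'` an orientation of `M̂` with `(Σ, μ) = bM`, `{λᵢ, μⱼ} = b` a basis of `Hᵏ(M̂; ℤ)/T`
with `λᵢ·λⱼ = 0`, `λᵢ·μⱼ = δᵢⱼ` for the cup-product form, and `ν` a framed family of `r`
disjoint embedded `k`-spheres in `M` **realising the `λᵢ`**: the class of the `i`-th sphere in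
`Hₖ(M̂)` is Poincaré dual to a lift of `λᵢ`. Then (1) `ρ : Hₖ(M) → Hₖ(M | ⋃ Sᵢ)` is onto (the
classes `q_*⁻¹(μⱼ ⌢ [M̂])` are dual to the spheres) and (2) `ker ρ` is spanned by the sphere
classes (a class meeting no sphere has all `μⱼ`-coordinates zero) — the hypotheses of
`FramedSphereFamily.isZero_singularHomology_surgered_middle` /`…_of_le`. The local homology at the
spheres is read through `SphereProd.SphereTube.exists_reading` (the Poincaré dual of a framed
sphere, up to sign); the transfers are `q_* : Hₖ(M) ≅ Hₖ(M̂)`, duality modulo torsion on `M̂`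
(`closedModel_dualityModTorsion_of_isOrientedBy`) and the freeness of `HₖM`
(`eq_zero_of_mem_torsion_singularHomology_closedModel`).
[cite: KervaireMilnorAnnals1963, Lemma 7.1, proof p. 527 l. 1–9, with §7 p. 528 and footnote pp. 528–529] [cite: Kosinski1993, Ch. X §3, p. 204 ([D, VIII, 13.5]) and proof of Thm. (3.4) ("Since e₁·f₁ = 1, S is primitive")] -/
theorem HomotopySphere.surjective_toLocalOfSet_cores_and_ker_le_span {k : ℕ} (hk : 3 ≤ k)
    (hkn : k + k = n + 1) (S : HomotopySphere n) (c : NullCobordism n S.carrier)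
    [SimplyConnectedSpace c.W] {μ : HomologicalOrientation ℤ S.carrier n}
    {μ' : HomologicalOrientation ℤ (ClosedModel n c.W) (n + 1)} (hob : c.IsOrientedBy μ μ')
    (hH : IsZero (singularHomology ℤ ℤ c.W (k - 1))) {r : ℕ}
    (ν : FramedSphereFamily (𝓡∂ (n + 1)) c.W (Fin r) k k)
    (b : Module.Basis (Fin r ⊕ Fin r) ℤ (freeCohomology ℤ (ClosedModel n c.W) k))
    (hiso : ∀ i j, intersectionForm hkn μ' (b (Sum.inl i)) (b (Sum.inl j)) = 0)
    (hdual : ∀ i j, intersectionForm hkn μ' (b (Sum.inl i)) (b (Sum.inr j)) = if i = j then 1 else 0)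
    (hreal : ∀ i, ∃ (a : singularCohomology ℤ ℤ (ClosedModel n c.W) k)
        (θ : singularHomology ℤ ℤ (Metric.sphere (0 : EuclideanSpace ℝ (Fin (k + 1))) 1) k),
        freeCohomology.mk a = b (Sum.inl i) ∧
        singularHomology.map ℤ ℤ ((boundaryCollapse n c.W).comp ⟨ν.sphere i, ν.continuous_sphere i⟩) k θ =
          capProduct hkn a μ'.fundamentalClass) :
    Surjective (singularHomology.toLocalOfSet ℤ ℤ c.W ν.cores k) ∧
    ∀ x : singularHomology ℤ ℤ c.W k, singularHomology.toLocalOfSet ℤ ℤ c.W ν.cores k x = 0 →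
      x ∈ Submodule.span ℤ (⋃ i, range (singularHomology.map ℤ ℤ ⟨ν.sphere i, ν.continuous_sphere i⟩ k)) := by
  obtain ⟨k', rfl⟩ : ∃ k', k = k' + 1 := ⟨k - 1, by omega⟩
  have hk2 : 2 ≤ k' + 1 := by omega
  have hn1 : 1 ≤ n := by omega
  have hkl : k' + 1 + k' = n := by omega
  haveI : Nonempty S.carrier := S.nonempty
  have hfc : IsFundamentalClass μ' μ'.fundamentalClass := hob.isFundamentalClass_fundamentalClass c hn1
  have htor := HomotopySphere.eq_zero_of_mem_torsion_singularHomology_closedModel hk hkn S c hH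
  -- (0) `q_* : Hₖ(M) ≅ Hₖ(M̂)` and duality modulo torsion on `M̂`
  have iq : IsIso (singularHomology.map ℤ ℤ (boundaryCollapse n c.W) (k' + 1)) := by
    obtain ⟨n', rfl⟩ : ∃ n', n = n' + 1 := ⟨n - 1, by omega⟩
    exact S.isIso_singularHomologyMap_boundaryCollapse c k' (by omega) (by omega) (by omega)
  have hqb := (ConcreteCategory.isIso_iff_bijective (singularHomology.map ℤ ℤ (boundaryCollapse n c.W) (k' + 1))).1 iq
  obtain ⟨-, hsurjT, -, -⟩ := S.closedModel_dualityModTorsion_of_isOrientedBy c hob ⟨_, hfc⟩ hk hkn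
  have hPDsurj : ∀ z : singularHomology ℤ ℤ (ClosedModel n c.W) (k' + 1), ∃ a : singularCohomology ℤ ℤ (ClosedModel n c.W) (k' + 1),
      z = capProduct hkn a μ'.fundamentalClass := fun z => by
    obtain ⟨a, ha⟩ := hsurjT z
    refine ⟨a, ?_⟩
    rw [← sub_eq_zero, ← poincareDualityMap_apply]
    exact htor _ ha
  -- (1) the tubes pushed to `M̂` are open embeddings
  have hE : ∀ i, IsOpenEmbedding (fun p => (boundaryCollapse n c.W) (ν.toFun i p)) := fun i =>
    c.isOpenEmbedding_boundaryCollapse_comp_tube ν hkl i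
  -- (2) the readings of `Hₖ(M̂ | q(Sᵢ))` and the Poincaré-dual formula for `[M̂]`
  have hrd := fun i => SphereProd.SphereTube.exists_reading (Y := (ClosedModel n c.W)) hk2 (hE i)
  choose rd hbij hform using hrd
  have hgen : ∀ i, ∃ e : localHomology ℤ ℤ (ClosedModel n c.W)
      ((fun p => (boundaryCollapse n c.W) (ν.toFun i p)) (SphereProd.northPole (k' + 1), 0)) (n + 1) ≃ₗ[ℤ] ℤ,
      e (singularHomology.toLocal ℤ ℤ ((fun p => (boundaryCollapse n c.W) (ν.toFun i p)) (SphereProd.northPole (k' + 1), 0))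
        (n + 1) μ'.fundamentalClass) = 1 := fun i => by
    rw [hfc]
    exact μ'.isGenerator _
  have hsgn := fun i => hform i hkn μ'.fundamentalClass (SphereProd.northPole (k' + 1)) (hgen i)
  choose ε hε hval using hsgn
  -- the sphere classes `ŝᵢ = (q ∘ Sᵢ)_* [Sᵏ]`
  have hval' : ∀ i (cc : singularCohomology ℤ ℤ (ClosedModel n c.W) (k' + 1)),
      rd i (singularHomology.toLocalOfSet ℤ ℤ (ClosedModel n c.W) ((fun p => (boundaryCollapse n c.W) (ν.toFun i p)) '' (univ ×ˢ ({0} : Set (EuclideanSpace ℝ (Fin (k' + 1)))))) (k' + 1)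
        (capProduct hkn cc μ'.fundamentalClass)) =
      ε i * kroneckerPairing ℤ ℤ (ClosedModel n c.W) (k' + 1) cc
        (singularHomology.map ℤ ℤ ((boundaryCollapse n c.W).comp ⟨ν.sphere i, ν.continuous_sphere i⟩) (k' + 1)
          (SphereProd.μS hk2).fundamentalClass) := by
    intro i cc
    rw [hval i cc, kroneckerPairing_map]
    rfl
  -- (3) the maps of pairs along `q`
  have hint : ∀ i p, ν.toFun i p ∈ (𝓡∂ (n + 1)).interior c.W := fun i p =>
    ν.isInteriorPoint_apply hkl i p
  have mq : ∀ i, MapsTo (boundaryCollapse n c.W) (ν.toFun i '' (univ ×ˢ ({0} : Set (EuclideanSpace ℝ (Fin (k' + 1))))))ᶜ ((fun p => (boundaryCollapse n c.W) (ν.toFun i p)) '' (univ ×ˢ ({0} : Set (EuclideanSpace ℝ (Fin (k' + 1))))))ᶜ := by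
    intro i x hx hmem
    obtain ⟨p, hp, he⟩ := hmem
    apply hx
    by_cases hxi : x ∈ (𝓡∂ (n + 1)).interior c.W
    · change (boundaryCollapse n c.W) (ν.toFun i p) = (boundaryCollapse n c.W) x at he
      rw [boundaryCollapse_of_mem_interior (hint i p), boundaryCollapse_of_mem_interior hxi] at he
      have hpx : ν.toFun i p = x := congrArg Subtype.val (OnePoint.coe_injective he)
      exact ⟨p, hp, hpx⟩
    · exfalso
      have hxb : x ∈ (𝓡∂ (n + 1)).boundary c.W := by
        rw [← ModelWithCorners.compl_interior]; exact hxi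
      change (boundaryCollapse n c.W) (ν.toFun i p) = (boundaryCollapse n c.W) x at he
      rw [boundaryCollapse_of_mem_interior (hint i p), boundaryCollapse_of_mem_boundary hxb] at he
      exact OnePoint.coe_ne_infty _ he
  have mW : ∀ i, MapsTo (ν.toFun i) (univ ×ˢ ({0} : Set (EuclideanSpace ℝ (Fin (k' + 1)))))ᶜ (ν.toFun i '' (univ ×ˢ ({0} : Set (EuclideanSpace ℝ (Fin (k' + 1))))))ᶜ := fun i =>
    SphereProd.SphereTube.mapsTo_compl_core (ν.injective i)
  have mM : ∀ i, MapsTo (fun p => (boundaryCollapse n c.W) (ν.toFun i p)) (univ ×ˢ ({0} : Set (EuclideanSpace ℝ (Fin (k' + 1)))))ᶜ ((fun p => (boundaryCollapse n c.W) (ν.toFun i p)) '' (univ ×ˢ ({0} : Set (EuclideanSpace ℝ (Fin (k' + 1))))))ᶜ := fun i =>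
    SphereProd.SphereTube.mapsTo_compl_core (hE i).injective
  have iW : ∀ i, IsIso (relativeSingularHomology.map ℤ ℤ (⟨ν.toFun i, (ν.isOpenEmbedding_toFun i).continuous⟩ : C(((Metric.sphere (0 : EuclideanSpace ℝ (Fin (k' + 1 + 1))) 1) × EuclideanSpace ℝ (Fin (k' + 1))), c.W)) (mW i) (k' + 1)) := fun i =>
    isIso_relMap_of_isOpenEmbedding ℤ ℤ (ν.isOpenEmbedding_toFun i)
      (((isCompact_univ.prod isCompact_singleton).image (ν.continuous i)).isClosed) (mW i) (k' + 1)
  have iM : ∀ i, IsIso (relativeSingularHomology.map ℤ ℤ (⟨fun p => (boundaryCollapse n c.W) (ν.toFun i p), (hE i).continuous⟩ : C(((Metric.sphere (0 : EuclideanSpace ℝ (Fin (k' + 1 + 1))) 1) × EuclideanSpace ℝ (Fin (k' + 1))), (ClosedModel n c.W))) (mM i) (k' + 1)) := fun i =>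
    isIso_relMap_of_isOpenEmbedding ℤ ℤ (hE i)
      (((isCompact_univ.prod isCompact_singleton).image (hE i).continuous).isClosed) (mM i) (k' + 1)
  have hfac : ∀ i, relativeSingularHomology.map ℤ ℤ (⟨fun p => (boundaryCollapse n c.W) (ν.toFun i p), (hE i).continuous⟩ : C(((Metric.sphere (0 : EuclideanSpace ℝ (Fin (k' + 1 + 1))) 1) × EuclideanSpace ℝ (Fin (k' + 1))), (ClosedModel n c.W))) (mM i) (k' + 1) =
      relativeSingularHomology.map ℤ ℤ (⟨ν.toFun i, (ν.isOpenEmbedding_toFun i).continuous⟩ : C(((Metric.sphere (0 : EuclideanSpace ℝ (Fin (k' + 1 + 1))) 1) × EuclideanSpace ℝ (Fin (k' + 1))), c.W)) (mW i) (k' + 1) ≫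
        relativeSingularHomology.map ℤ ℤ (boundaryCollapse n c.W) (mq i) (k' + 1) := by
    intro i
    rw [← relativeSingularHomology.map_comp]
    rfl
  have iqrel : ∀ i, IsIso (relativeSingularHomology.map ℤ ℤ (boundaryCollapse n c.W) (mq i) (k' + 1)) := by
    intro i
    haveI := iW i
    haveI : IsIso (relativeSingularHomology.map ℤ ℤ (⟨ν.toFun i, (ν.isOpenEmbedding_toFun i).continuous⟩ : C(((Metric.sphere (0 : EuclideanSpace ℝ (Fin (k' + 1 + 1))) 1) × EuclideanSpace ℝ (Fin (k' + 1))), c.W)) (mW i) (k' + 1) ≫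
        relativeSingularHomology.map ℤ ℤ (boundaryCollapse n c.W) (mq i) (k' + 1)) := by
      rw [← hfac i]; exact iM i
    exact IsIso.of_isIso_comp_left (relativeSingularHomology.map ℤ ℤ (⟨ν.toFun i, (ν.isOpenEmbedding_toFun i).continuous⟩ : C(((Metric.sphere (0 : EuclideanSpace ℝ (Fin (k' + 1 + 1))) 1) × EuclideanSpace ℝ (Fin (k' + 1))), c.W)) (mW i) (k' + 1)) _
  -- the pieces `Kᵢ = φᵢ(Sᵏ × 0)` of the cores
  have hKsub : ∀ i, (ν.toFun i '' (univ ×ˢ ({0} : Set (EuclideanSpace ℝ (Fin (k' + 1)))))) ⊆ ν.cores := fun i => by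
    rw [ν.cores_eq_iUnion]
    exact subset_iUnion (fun j => (ν.toFun j '' (univ ×ˢ ({0} : Set (EuclideanSpace ℝ (Fin (k' + 1))))))) i
  -- (4) naturality along `q`
  have hψ : ∀ i (x : singularHomology ℤ ℤ c.W (k' + 1)),
      relativeSingularHomology.map ℤ ℤ (boundaryCollapse n c.W) (mq i) (k' + 1)
        (restrictLocal ℤ ℤ (hKsub i) (k' + 1) (singularHomology.toLocalOfSet ℤ ℤ c.W ν.cores (k' + 1) x)) =
      singularHomology.toLocalOfSet ℤ ℤ (ClosedModel n c.W) ((fun p => (boundaryCollapse n c.W) (ν.toFun i p)) '' (univ ×ˢ ({0} : Set (EuclideanSpace ℝ (Fin (k' + 1)))))) (k' + 1)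
        (singularHomology.map ℤ ℤ (boundaryCollapse n c.W) (k' + 1) x) := by
    intro i x
    rw [singularHomology.restrictLocal_toLocalOfSet, singularHomology.toLocalOfSet,
      singularHomology.toLocalOfSet, ← ModuleCat.comp_apply,
      relativeSingularHomology.ofAbsolute_comp_map, ModuleCat.comp_apply]
  -- (5) the realisation data
  choose a θ hmk hsph using hreal
  have hθ := fun i => SphereProd.exists_eq_smul_fundamentalClass_sphere hk2 (θ i)
  choose d hd using hθ
  -- `PD aᵢ = dᵢ • ŝᵢ`
  have hPD : ∀ i, capProduct hkn (a i) μ'.fundamentalClass =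
      d i • singularHomology.map ℤ ℤ ((boundaryCollapse n c.W).comp ⟨ν.sphere i, ν.continuous_sphere i⟩) (k' + 1)
        (SphereProd.μS hk2).fundamentalClass := by
    intro i; rw [← hsph i, hd i, map_zsmul]
  -- `aᵢ · cc = dᵢ ⟨cc, ŝᵢ⟩`
  have hpair : ∀ i (cc : singularCohomology ℤ ℤ (ClosedModel n c.W) (k' + 1)),
      cupPairing μ' hkn (a i) cc = d i * kroneckerPairing ℤ ℤ (ClosedModel n c.W) (k' + 1) cc
        (singularHomology.map ℤ ℤ ((boundaryCollapse n c.W).comp ⟨ν.sphere i, ν.continuous_sphere i⟩) (k' + 1)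
          (SphereProd.μS hk2).fundamentalClass) := by
    intro i cc
    rw [cupPairing_eq_kroneckerPairing_poincareDualityMap, poincareDualityMap_apply, hPD i, map_zsmul,
      smul_eq_mul]
  -- the coordinates on the `μⱼ`: `λᵢ · v = (b.repr v) (inr i)`
  have hcoef : ∀ i (v : freeCohomology ℤ (ClosedModel n c.W) (k' + 1)),
      intersectionForm hkn μ' (b (Sum.inl i)) v = b.repr v (Sum.inr i) := by
    intro i
    have hfun : (intersectionForm hkn μ' (b (Sum.inl i)) : freeCohomology ℤ (ClosedModel n c.W) (k' + 1) →ₗ[ℤ] ℤ) =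
        b.coord (Sum.inr i) := by
      refine b.ext fun s => ?_
      rcases s with j | j
      · rw [hiso, Module.Basis.coord_apply, b.repr_self, Finsupp.single_apply]
        simp
      · rw [hdual, Module.Basis.coord_apply, b.repr_self, Finsupp.single_apply]
        simp [eq_comm]
    intro v
    rw [hfun, Module.Basis.coord_apply]
  -- `uᵢⱼ := ⟨a'ⱼ, ŝᵢ⟩` for lifts `a'ⱼ` of the `μⱼ`: `dᵢ uᵢⱼ = δᵢⱼ`
  have ha' := fun j => freeCohomology.mk_surjective (R := ℤ) (X := (ClosedModel n c.W)) (k := k' + 1) (b (Sum.inr j))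
  choose a' hma' using ha'
  have hu : ∀ i j, d i * kroneckerPairing ℤ ℤ (ClosedModel n c.W) (k' + 1) (a' j)
      (singularHomology.map ℤ ℤ ((boundaryCollapse n c.W).comp ⟨ν.sphere i, ν.continuous_sphere i⟩) (k' + 1)
        (SphereProd.μS hk2).fundamentalClass) = if i = j then 1 else 0 := by
    intro i j
    rw [← hpair i (a' j), ← intersectionForm_mk_mk, hmk i, hma' j, hdual i j]
  have hd1 : ∀ i, d i = 1 ∨ d i = -1 := fun i => by
    have h := hu i i
    rw [if_pos rfl] at h
    exact Int.eq_one_or_neg_one_of_mul_eq_one h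
  have hd0 : ∀ i, d i ≠ 0 := fun i h => by rcases hd1 i with h1 | h1 <;> omega
  have huij : ∀ i j, kroneckerPairing ℤ ℤ (ClosedModel n c.W) (k' + 1) (a' j)
      (singularHomology.map ℤ ℤ ((boundaryCollapse n c.W).comp ⟨ν.sphere i, ν.continuous_sphere i⟩) (k' + 1)
        (SphereProd.μS hk2).fundamentalClass) = if i = j then d i else 0 := by
    intro i j
    have h := hu i j
    split_ifs at h ⊢ with hij
    · rcases hd1 i with h1 | h1 <;> rw [h1] at h ⊢ <;> linarith
    · exact (mul_eq_zero.1 h).resolve_left (hd0 i)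
  -- the dual classes `yⱼ ∈ Hₖ(M)` with `q_* yⱼ = μⱼ ⌢ [M̂]`
  have hy := fun j => hqb.2 (capProduct hkn (a' j) μ'.fundamentalClass)
  choose y hy using hy
  refine ⟨?_, ?_⟩
  · -- (i) surjectivity
    intro t
    set v : Fin r → ℤ := fun i => rd i (relativeSingularHomology.map ℤ ℤ (boundaryCollapse n c.W) (mq i) (k' + 1)
      (restrictLocal ℤ ℤ (hKsub i) (k' + 1) t)) with hv
    refine ⟨∑ j, (ε j * d j * v j) • y j, ?_⟩
    -- it suffices to check all the readings
    rw [← sub_eq_zero]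
    have hcores : ν.cores = ⋃ i ∈ (Finset.univ : Finset (Fin r)), (ν.toFun i '' (univ ×ˢ ({0} : Set (EuclideanSpace ℝ (Fin (k' + 1)))))) := by
      rw [ν.cores_eq_iUnion]; simp
    refine localHomologyOfSet.eq_zero_of_forall_restrictLocal_biUnion
      (fun i => (ν.toFun i '' (univ ×ˢ ({0} : Set (EuclideanSpace ℝ (Fin (k' + 1))))))) (fun i => ((isCompact_univ.prod isCompact_singleton).image (ν.continuous i)).isClosed)
      ν.pairwise_disjoint_image_core (k' + 1) Finset.univ ν.cores hcores _ fun i _ => ?_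
    -- reading `i`
    have hinj : Function.Injective (fun z : localHomologyOfSet ℤ ℤ c.W (ν.toFun i '' (univ ×ˢ ({0} : Set (EuclideanSpace ℝ (Fin (k' + 1)))))) (k' + 1) =>
        rd i (relativeSingularHomology.map ℤ ℤ (boundaryCollapse n c.W) (mq i) (k' + 1) z)) :=
      (hbij i).1.comp ((ConcreteCategory.isIso_iff_bijective _).1 (iqrel i)).1
    apply hinj
    beta_reduce
    rw [map_zero, map_zero, map_sub, map_sub, map_sub, sub_eq_zero]
    change _ = v i
    rw [hψ, map_sum]
    simp only [map_zsmul, hy]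
    -- `q_* y = PD (∑ (εⱼ dⱼ vⱼ) • a'ⱼ)`
    have hsum : (∑ j, (ε j * d j * v j) • capProduct hkn (a' j) μ'.fundamentalClass :
        singularHomology ℤ ℤ (ClosedModel n c.W) (k' + 1)) =
        capProduct hkn (∑ j, (ε j * d j * v j) • a' j : singularCohomology ℤ ℤ (ClosedModel n c.W) (k' + 1))
          μ'.fundamentalClass := by
      rw [map_sum, LinearMap.sum_apply]
      refine (Finset.sum_congr rfl fun j _ => ?_).symm
      change capProduct hkn ((ε j * d j * v j) • a' j) μ'.fundamentalClass = _
      rw [map_zsmul]; rfl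
    rw [hsum, hval' i]
    have hlin : kroneckerPairing ℤ ℤ (ClosedModel n c.W) (k' + 1) (∑ j, (ε j * d j * v j) • a' j)
        (singularHomology.map ℤ ℤ ((boundaryCollapse n c.W).comp ⟨ν.sphere i, ν.continuous_sphere i⟩) (k' + 1)
          (SphereProd.μS hk2).fundamentalClass) =
        ∑ j, (ε j * d j * v j) * kroneckerPairing ℤ ℤ (ClosedModel n c.W) (k' + 1) (a' j)
          (singularHomology.map ℤ ℤ ((boundaryCollapse n c.W).comp ⟨ν.sphere i, ν.continuous_sphere i⟩) (k' + 1)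
            (SphereProd.μS hk2).fundamentalClass) := by
      rw [map_sum, LinearMap.sum_apply]
      refine Finset.sum_congr rfl fun j _ => ?_
      rw [map_zsmul]
      change (ε j * d j * v j) • kroneckerPairing ℤ ℤ (ClosedModel n c.W) (k' + 1) (a' j) _ = _
      rw [smul_eq_mul]
    rw [hlin]
    simp only [huij, mul_ite, mul_zero, Finset.sum_ite_eq, Finset.mem_univ, if_true]
    rcases hε i with h | h <;> rcases hd1 i with h' | h' <;> rw [h, h'] <;> ring
  · -- (ii) the kernel is spanned by the spheres
    intro x hx
    have h0 : ∀ i, rd i (singularHomology.toLocalOfSet ℤ ℤ (ClosedModel n c.W) ((fun p => (boundaryCollapse n c.W) (ν.toFun i p)) '' (univ ×ˢ ({0} : Set (EuclideanSpace ℝ (Fin (k' + 1)))))) (k' + 1)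
        (singularHomology.map ℤ ℤ (boundaryCollapse n c.W) (k' + 1) x)) = 0 := fun i => by
      rw [← hψ i x, hx, map_zero, map_zero, map_zero]
    obtain ⟨cc, hcc⟩ := hPDsurj (singularHomology.map ℤ ℤ (boundaryCollapse n c.W) (k' + 1) x)
    -- `⟨cc, ŝᵢ⟩ = 0`
    have hcc0 : ∀ i, kroneckerPairing ℤ ℤ (ClosedModel n c.W) (k' + 1) cc
        (singularHomology.map ℤ ℤ ((boundaryCollapse n c.W).comp ⟨ν.sphere i, ν.continuous_sphere i⟩) (k' + 1)
          (SphereProd.μS hk2).fundamentalClass) = 0 := fun i => by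
      have h := h0 i
      rw [hcc, hval' i cc] at h
      rcases hε i with h1 | h1 <;> rw [h1] at h <;> simpa using h
    -- the `μ`-coordinates of `v = [cc]` vanish, so `v` lies in the span of the `λᵢ = [aᵢ]`
    have hinr : ∀ i, b.repr (freeCohomology.mk cc) (Sum.inr i) = 0 := fun i => by
      rw [← hcoef i, ← hmk i, intersectionForm_mk_mk, hpair i cc, hcc0 i, mul_zero]
    have hvspan : freeCohomology.mk cc ∈ Submodule.span ℤ (b '' range Sum.inl) := by
      rw [b.mem_span_image]
      intro s hs
      rcases s with j | j
      · exact mem_range_self j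
      · exfalso
        exact (Finsupp.mem_support_iff.1 hs) (hinr j)
    have himage : b '' range Sum.inl = freeCohomology.mk '' range a := by
      ext v
      simp only [mem_image, mem_range, exists_exists_eq_and]
      constructor
      · rintro ⟨j, rfl⟩; exact ⟨j, hmk j⟩
      · rintro ⟨j, rfl⟩; exact ⟨j, (hmk j).symm⟩
    rw [himage, Submodule.span_image] at hvspan
    obtain ⟨w, hw, hwcc⟩ := Submodule.mem_map.1 hvspan
    -- `cc - w` is torsion, hence `PD cc = PD w`
    have hPDw : capProduct hkn cc μ'.fundamentalClass = capProduct hkn w μ'.fundamentalClass := by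
      rw [← sub_eq_zero, ← poincareDualityMap_apply, ← poincareDualityMap_apply, ← map_sub]
      refine htor _ (mem_torsion_map_of_mem_torsion (poincareDualityMap μ' hkn) ?_)
      rw [← freeCohomology.ker_mk, LinearMap.mem_ker, map_sub, sub_eq_zero]
      exact hwcc.symm
    -- `PD (span aᵢ) ⊆ q_* (span of the sphere classes)`
    have hle : Submodule.map (poincareDualityMap μ' hkn) (Submodule.span ℤ (range a)) ≤
        Submodule.map (singularHomology.map ℤ ℤ (boundaryCollapse n c.W) (k' + 1)).hom
          (Submodule.span ℤ (⋃ i, range (singularHomology.map ℤ ℤ ⟨ν.sphere i, ν.continuous_sphere i⟩ (k' + 1)))) := by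
      rw [Submodule.map_span, Submodule.span_le]
      rintro _ ⟨_, ⟨i, rfl⟩, rfl⟩
      refine ⟨singularHomology.map ℤ ℤ ⟨ν.sphere i, ν.continuous_sphere i⟩ (k' + 1) (θ i),
        Submodule.subset_span (mem_iUnion.2 ⟨i, mem_range_self _⟩), ?_⟩
      change singularHomology.map ℤ ℤ (boundaryCollapse n c.W) (k' + 1) _ = poincareDualityMap μ' hkn (a i)
      rw [poincareDualityMap_apply, ← hsph i, singularHomology.map_comp, ModuleCat.comp_apply]
    have hmem : singularHomology.map ℤ ℤ (boundaryCollapse n c.W) (k' + 1) x ∈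
        Submodule.map (singularHomology.map ℤ ℤ (boundaryCollapse n c.W) (k' + 1)).hom
          (Submodule.span ℤ (⋃ i, range (singularHomology.map ℤ ℤ ⟨ν.sphere i, ν.continuous_sphere i⟩ (k' + 1)))) := by
      refine hle ⟨w, hw, ?_⟩
      rw [poincareDualityMap_apply, ← hPDw, ← hcc]
    obtain ⟨x', hx', hxx'⟩ := Submodule.mem_map.1 hmem
    rw [← hqb.1 hxx']
    exact hx'

end Reading

/-! ### Thm. 7.5, Cor. 7.6 and `Θ₇` over the geometric residual of Lemma 7.1 -/

section Assembly

namespace HomotopySphere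

variable {n : ℕ}

/-- **The homological hypotheses (`hrep`) of `lemma71_of_sphereFamily` from the geometric half of
Lemma 7.1 (`hgeo`).** GIVEN, as a plain hypothesis, the differential-topological input of
Kervaire–Milnor's proof of Lemma 7.1 / Lemma 7.3 (p. 527 l. 1–6 and p. 529): *in a simply
connected, `(2m-1)`-connected, s-parallelizable null-cobordism `M` (dimension `4m ≥ 8`) of a
homotopy sphere, finitely many classes `λ₁, …, λᵣ ∈ H²ᵐ(M̂; ℤ)` with `λᵢ·λⱼ = 0` for all `i, j`
(cup-product pairing on the closed model) are Poincaré dual to the classes of `r` disjoint framed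
embedded `2m`-spheres in `M`* — "According to [17, Lemma 6] or Haefliger [6] any homology class
in `HₖM` can be represented by a differentiably imbedded sphere" (Whitney; `k ≥ 3`), made pairwise
disjoint by Whitney's procedure (Milnor 1965, Thm. 6.6; Wall 1970, Thm. 5.2 (ii): a basis of a
sublagrangian is realised by disjoint framed embedded spheres), with trivial normal bundles since
"the self-intersection number `λ·λ` is zero. Therefore, according to [17, Lemma 7], the normal
bundle is trivial" (p. 529; Kosinski X.3.1) — the two homological conditions of the surgical engine
hold for a Kervaire–Milnor basis: `Hₖ(M) → Hₖ(M | ⋃ Sᵢ)` is onto and its kernel is spanned by the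
sphere classes (`surjective_toLocalOfSet_cores_and_ker_le_span`, PROVED: Thom/Poincaré-dual reading
of the local homology at a framed sphere, duality on `M̂`, freeness of `HₖM`).
[cite: KervaireMilnorAnnals1963, Lemma 7.1 proof p. 527 l. 1–9, Lemma 7.3 proof p. 529] [cite: MilnorKilling1961, Lemmas 6 and 7] [cite: MilnorHCobordism1965, Thm. 6.6] [cite: Kosinski1993, Ch. X, Prop. (3.1)] -/
theorem sphereFamily_of_representation
    (hgeo : ∀ (n m : ℕ) (h : n + 1 = 4 * m), 1 < m →
      ∀ (S : HomotopySphere n) (c : NullCobordism n S.carrier)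
        (μ : HomologicalOrientation ℤ S.carrier n)
        (μ' : HomologicalOrientation ℤ (ClosedModel n c.W) (n + 1)),
        SimplyConnectedSpace c.W →
        (∀ i : ℕ, 0 < i → i < 2 * m → Subsingleton (singularHomology ℤ ℤ c.W i)) →
        IsStablyParallelizable (𝓡∂ (n + 1)) c.W → c.IsOrientedBy μ μ' →
        ∀ (r : ℕ) (a : Fin r → singularCohomology ℤ ℤ (ClosedModel n c.W) (2 * m)),
          (∀ i j, cupPairing μ' (show 2 * m + 2 * m = n + 1 by omega) (a i) (a j) = 0) →
          ∃ ν : FramedSphereFamily (𝓡∂ (n + 1)) c.W (Fin r) (2 * m) (2 * m),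
            ∀ i, ∃ θ : singularHomology ℤ ℤ (Metric.sphere (0 : EuclideanSpace ℝ (Fin (2 * m + 1))) 1) (2 * m),
              singularHomology.map ℤ ℤ ((boundaryCollapse n c.W).comp ⟨ν.sphere i, ν.continuous_sphere i⟩)
                (2 * m) θ = capProduct (show 2 * m + 2 * m = n + 1 by omega) (a i) μ'.fundamentalClass)
    (n m : ℕ) (h : n + 1 = 4 * m) (hm : 1 < m)
    (S : HomotopySphere n) (c : NullCobordism n S.carrier)
    (μ : HomologicalOrientation ℤ S.carrier n)
    (μ' : HomologicalOrientation ℤ (ClosedModel n c.W) (n + 1))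
    (hsc : SimplyConnectedSpace c.W)
    (hH : ∀ i : ℕ, 0 < i → i < 2 * m → Subsingleton (singularHomology ℤ ℤ c.W i))
    (hspar : IsStablyParallelizable (𝓡∂ (n + 1)) c.W) (hob : c.IsOrientedBy μ μ')
    (hbasis : ∃ (r : ℕ) (b : Module.Basis (Fin r ⊕ Fin r) ℤ
        (freeCohomology ℤ (ClosedModel n c.W) (2 * m))),
      Module.finrank ℤ (freeCohomology ℤ (ClosedModel n c.W) (2 * m)) = 2 * r ∧
      (∀ i j, intersectionForm (show 2 * m + 2 * m = n + 1 by omega) μ'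
        (b (Sum.inl i)) (b (Sum.inl j)) = 0) ∧
      ∀ i j, intersectionForm (show 2 * m + 2 * m = n + 1 by omega) μ'
        (b (Sum.inl i)) (b (Sum.inr j)) = if i = j then 1 else 0) :
    ∃ (ι : Type) (_ : Fintype ι) (ν : FramedSphereFamily (𝓡∂ (n + 1)) c.W ι (2 * m) (2 * m)),
      Function.Surjective (singularHomology.toLocalOfSet ℤ ℤ c.W ν.cores (2 * m)) ∧
      ∀ x : singularHomology ℤ ℤ c.W (2 * m),
        singularHomology.toLocalOfSet ℤ ℤ c.W ν.cores (2 * m) x = 0 →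
          x ∈ Submodule.span ℤ (⋃ i, Set.range
            (singularHomology.map ℤ ℤ ⟨ν.sphere i, ν.continuous_sphere i⟩ (2 * m))) := by
  obtain ⟨r, b, -, hiso, hdual⟩ := hbasis
  haveI := hsc
  -- lift the `λᵢ`
  have ha := fun i => freeCohomology.mk_surjective (R := ℤ) (X := ClosedModel n c.W) (k := 2 * m)
    (b (Sum.inl i))
  choose a ha using ha
  have hcup : ∀ i j, cupPairing μ' (show 2 * m + 2 * m = n + 1 by omega) (a i) (a j) = 0 := by
    intro i j
    rw [← intersectionForm_mk_mk, ha i, ha j, hiso i j]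
  obtain ⟨ν, hν⟩ := hgeo n m h hm S c μ μ' hsc hH hspar hob r a hcup
  refine ⟨Fin r, inferInstance, ν, ?_⟩
  have hHk : IsZero (singularHomology ℤ ℤ c.W (2 * m - 1)) := by
    haveI := hH (2 * m - 1) (by omega) (by omega)
    exact ModuleCat.isZero_of_subsingleton _
  exact surjective_toLocalOfSet_cores_and_ker_le_span (by omega)
    (show 2 * m + 2 * m = n + 1 by omega) S c hob hHk ν b hiso hdual
    fun i => ⟨a i, (hν i).choose, ha i, (hν i).choose_spec⟩

/-- **Kervaire–Milnor Thm. 7.5 over its geometric residual.** The named fact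
`Literature.Topology.FourManifolds.HomotopySphere.mk_eq_mk_iff_sigmaGen_dvd_sub` (Kervaire–Milnor
1963, Thm. 7.5) GIVEN exactly three inputs that are not theorems of the tree, all of them
differential topology: (`hgeo`) the geometric half of Lemma 7.1 — in a simply connected,
`(2m-1)`-connected, s-parallelizable null-cobordism of a homotopy sphere (`4m ≥ 8`), classes
`λ₁, …, λᵣ ∈ H²ᵐ(M̂; ℤ)` with all `λᵢ·λⱼ = 0` are Poincaré dual to `r` disjoint framed embedded
`2m`-spheres ([17, Lemmas 6, 7], Haefliger, Whitney's procedure; p. 527 l. 1–6, p. 529);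
(`hconn`) the named fact `exists_highlyConnected_of_mem_signatureSet` (Kosinski X.2.2 / Thm. 5.5,
framed surgery below the middle dimension); (`hcob`) the named fact
`nonempty_diffeomorph_of_isHCobordant_of_five_le` (Smale's h-cobordism theorem). PROVED around
them, along the printed proof: the algebra of p. 529 (Kervaire–Milnor basis,
`exists_basis_isotropic_dual_intersectionForm_closedModel`), the reading of the intersection
numbers with the `λᵢ` as local classes at the spheres (`sphereFamily_of_representation`), the
surgery of Lemma 7.1 and Thm. 6.6 (`lemma71_of_sphereFamily`), Lemma 2.3, Thm. 1.1's group laws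
and §2-additivity (`mk_eq_mk_iff_sigmaGen_dvd_sub_of_sphereFamily`).
[cite: KervaireMilnorAnnals1963, Thm. 7.5 (pp. 529–530) with Lemma 7.1 (pp. 526–528), Lemma 7.3 (pp. 528–529), Thm. 5.5 (p. 514), Thm. 6.6 (p. 526)] [cite: MilnorKilling1961, Lemmas 6, 7] [cite: Kosinski1993, Ch. X, Thm. (2.2), Prop. (3.1), Thm. (3.4)] [cite: MilnorHCobordism1965, Thm. 6.6, Thm. 9.1] -/
theorem mk_eq_mk_iff_sigmaGen_dvd_sub_of_representation
    (hgeo : ∀ (n m : ℕ) (h : n + 1 = 4 * m), 1 < m →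
      ∀ (S : HomotopySphere n) (c : NullCobordism n S.carrier)
        (μ : HomologicalOrientation ℤ S.carrier n)
        (μ' : HomologicalOrientation ℤ (ClosedModel n c.W) (n + 1)),
        SimplyConnectedSpace c.W →
        (∀ i : ℕ, 0 < i → i < 2 * m → Subsingleton (singularHomology ℤ ℤ c.W i)) →
        IsStablyParallelizable (𝓡∂ (n + 1)) c.W → c.IsOrientedBy μ μ' →
        ∀ (r : ℕ) (a : Fin r → singularCohomology ℤ ℤ (ClosedModel n c.W) (2 * m)),
          (∀ i j, cupPairing μ' (show 2 * m + 2 * m = n + 1 by omega) (a i) (a j) = 0) →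
          ∃ ν : FramedSphereFamily (𝓡∂ (n + 1)) c.W (Fin r) (2 * m) (2 * m),
            ∀ i, ∃ θ : singularHomology ℤ ℤ (Metric.sphere (0 : EuclideanSpace ℝ (Fin (2 * m + 1))) 1) (2 * m),
              singularHomology.map ℤ ℤ ((boundaryCollapse n c.W).comp ⟨ν.sphere i, ν.continuous_sphere i⟩)
                (2 * m) θ = capProduct (show 2 * m + 2 * m = n + 1 by omega) (a i) μ'.fundamentalClass)
    (hconn : exists_highlyConnected_of_mem_signatureSet)
    (hcob : FourManifolds.nonempty_diffeomorph_of_isHCobordant_of_five_le.{0}) :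
    mk_eq_mk_iff_sigmaGen_dvd_sub :=
  mk_eq_mk_iff_sigmaGen_dvd_sub_of_sphereFamily (sphereFamily_of_representation hgeo) hconn hcob

end HomotopySphere

namespace HomotopySphereClass

open HomotopySphere

/-- **Kervaire–Milnor Cor. 7.6 (`bP₄ₘ` finite cyclic, `m > 1`) over the geometric residual of
Lemma 7.1** — the named fact `isCyclic_bP_four_mul` GIVEN: (`h74`) Lemma 7.4 in dimensions
`4m - 1`, `m > 1`; (`hgeo`) the geometric half of Lemma 7.1 (disjoint framed embedded `2m`-spheres
Poincaré dual to classes with vanishing mutual intersection numbers, [17, Lemmas 6, 7], Whitney);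
(`hconn`) X.2.2; (`hcob`) Smale. Everything else is proved (`isCyclic_bP_four_mul_of_sphereFamily`,
`sphereFamily_of_representation`).
[cite: KervaireMilnorAnnals1963, Cor. 7.6 (p. 530), with Thm. 7.5, Lemma 7.1 (pp. 526–528), Lemma 7.3 (p. 529), Lemma 7.4 (p. 529), Thm. 6.6 (p. 526)] [cite: MilnorKilling1961, Lemmas 6, 7] [cite: Kosinski1993, Ch. X, Thm. (2.2), Prop. (3.1)] [cite: MilnorHCobordism1965, Thm. 9.1] -/
theorem isCyclic_bP_four_mul_of_representation
    (h74 : ∀ (n m : ℕ) (h : n + 1 = 4 * m), 1 < m →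
      ∀ g : HomologicalOrientation ℤ (EuclideanSpace ℝ (Fin n)) n,
        ∃ (o : SmoothOrientation (𝓡 n) (Metric.sphere (0 : EuclideanSpace ℝ (Fin (n + 1))) 1))
          (σ : ℤ),
        σ ∈ signatureSet g m h ⟨Metric.sphere (0 : EuclideanSpace ℝ (Fin (n + 1))) 1, o, ⟨.refl _⟩⟩
          ∧ σ ≠ 0)
    (hgeo : ∀ (n m : ℕ) (h : n + 1 = 4 * m), 1 < m →
      ∀ (S : HomotopySphere n) (c : NullCobordism n S.carrier)
        (μ : HomologicalOrientation ℤ S.carrier n)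
        (μ' : HomologicalOrientation ℤ (ClosedModel n c.W) (n + 1)),
        SimplyConnectedSpace c.W →
        (∀ i : ℕ, 0 < i → i < 2 * m → Subsingleton (singularHomology ℤ ℤ c.W i)) →
        IsStablyParallelizable (𝓡∂ (n + 1)) c.W → c.IsOrientedBy μ μ' →
        ∀ (r : ℕ) (a : Fin r → singularCohomology ℤ ℤ (ClosedModel n c.W) (2 * m)),
          (∀ i j, cupPairing μ' (show 2 * m + 2 * m = n + 1 by omega) (a i) (a j) = 0) →
          ∃ ν : FramedSphereFamily (𝓡∂ (n + 1)) c.W (Fin r) (2 * m) (2 * m),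
            ∀ i, ∃ θ : singularHomology ℤ ℤ (Metric.sphere (0 : EuclideanSpace ℝ (Fin (2 * m + 1))) 1) (2 * m),
              singularHomology.map ℤ ℤ ((boundaryCollapse n c.W).comp ⟨ν.sphere i, ν.continuous_sphere i⟩)
                (2 * m) θ = capProduct (show 2 * m + 2 * m = n + 1 by omega) (a i) μ'.fundamentalClass)
    (hconn : exists_highlyConnected_of_mem_signatureSet)
    (hcob : FourManifolds.nonempty_diffeomorph_of_isHCobordant_of_five_le.{0}) :
    isCyclic_bP_four_mul :=
  isCyclic_bP_four_mul_of_sphereFamily h74 (sphereFamily_of_representation hgeo) hconn hcob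

end HomotopySphereClass

/-- **`Θ₇` is cyclic under connected sum, over the geometric residual of Lemma 7.1 at `n = 7`.**
The cone target `exists_commGroup_homotopySphereClass_isCyclic_seven` GIVEN: (`hgeo`) the
geometric half of Lemma 7.1 (all `n`, `m`; used at `n = 7`, `m = 2`: disjoint framed embedded
`4`-spheres in a `3`-connected s-parallelizable `8`-manifold Poincaré dual to classes of `H⁴(M̂; ℤ)`
with vanishing mutual cup products); (`hconn`) X.2.2; (`hcob`) Smale; (`hne`) Lemma 3.4 "⇒";
(`hB`) `Θ₇ = bP₈`. Everything else is proved.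
[cite: KervaireMilnorAnnals1963, Cor. 7.6 (p. 530, first sentence) at m = 2, with Thm. 7.5, Lemma 7.1 (pp. 526–528), Lemma 7.3 (p. 529), Thm. 6.6 (p. 526), §4 table p. 512] [cite: MilnorKilling1961, Lemmas 6, 7] [cite: Kosinski1993, Ch. X, Thm. (2.2), Prop. (3.1)] -/
theorem exists_commGroup_homotopySphereClass_isCyclic_seven_of_representation
    (hgeo : ∀ (n m : ℕ) (h : n + 1 = 4 * m), 1 < m →
      ∀ (S : HomotopySphere n) (c : NullCobordism n S.carrier)
        (μ : HomologicalOrientation ℤ S.carrier n)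
        (μ' : HomologicalOrientation ℤ (ClosedModel n c.W) (n + 1)),
        SimplyConnectedSpace c.W →
        (∀ i : ℕ, 0 < i → i < 2 * m → Subsingleton (singularHomology ℤ ℤ c.W i)) →
        IsStablyParallelizable (𝓡∂ (n + 1)) c.W → c.IsOrientedBy μ μ' →
        ∀ (r : ℕ) (a : Fin r → singularCohomology ℤ ℤ (ClosedModel n c.W) (2 * m)),
          (∀ i j, cupPairing μ' (show 2 * m + 2 * m = n + 1 by omega) (a i) (a j) = 0) →
          ∃ ν : FramedSphereFamily (𝓡∂ (n + 1)) c.W (Fin r) (2 * m) (2 * m),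
            ∀ i, ∃ θ : singularHomology ℤ ℤ (Metric.sphere (0 : EuclideanSpace ℝ (Fin (2 * m + 1))) 1) (2 * m),
              singularHomology.map ℤ ℤ ((boundaryCollapse n c.W).comp ⟨ν.sphere i, ν.continuous_sphere i⟩)
                (2 * m) θ = capProduct (show 2 * m + 2 * m = n + 1 by omega) (a i) μ'.fundamentalClass)
    (hconn : HomotopySphere.exists_highlyConnected_of_mem_signatureSet)
    (hcob : FourManifolds.nonempty_diffeomorph_of_isHCobordant_of_five_le.{0})
    (hne : HomotopySphere.nonempty_signatureSet_of_boundsParallelizable)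
    (hB : HomotopySphere.boundsParallelizable_seven) :
    exists_commGroup_homotopySphereClass_isCyclic_seven :=
  exists_commGroup_homotopySphereClass_isCyclic_seven_of_sphereFamily
    (HomotopySphere.sphereFamily_of_representation hgeo 7 2 (by norm_num) (by norm_num))
    hconn hcob hne hB

end Assembly

end Literature.Topology.FourManifolds
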